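import Mathlib
import Literature.NumberTheory.LFunctions.Zhang2022.AppendixAStepAu007Closers
import HarnessLib

/-!
# Zhang (2022), App. A p. 101 (§A.u007): the local factors `𝔱_j(d,h,s;q)` are holomorphic on `σ > 9/10`;
# hence BOTH App. A leaves `StepA_u007_analytic` (hAn) and `StepA_u007_read` (hRead) HOLD — kernel-checked

Topic `Literature/NumberTheory/LFunctions/Zhang2022` (Landau–Siegel audit tree; verdict-neutral).
Y. Zhang, *Discrete mean estimates and the Landau–Siegel zero*, arXiv:2211.02515v1 (2022)
[Zhang2022LandauSiegel] — **an unrefereed manuscript under adjudication; nothing here asserts or denies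
its Theorems 1–2.** ZHANG-L discharge lane (WP09). App. A p. 101, tex L4999: "we have
`𝔱_j(d,h,s;q) = 1 + O(q^{−9/5})` for `σ > 9/10`, so `𝒰_j(d,h;s)` is analytic in this region". The only
analytic input the two App. A leaves of `Skeleton.theorem1_of_leaves_v20` still need (`StepA_u007_analytic`
= hAn, `StepA_u007_read` = hRead) is

  `DifferentiableOn ℂ (s ↦ 𝔱_j(d,h,s;q)) {σ > 9/10}` for every prime `q`      (`differentiableOn_frakt`),

proved here (theorems only, no definitions, no facts; every `D`, every Dirichlet character, `1 ≤ j ≤ 3`,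
`d, h ≥ 1` — no largeness, no Assumption (A)) from:

* `norm_xiA_prime_pow_le_all` — `‖ξ_j(q^e;d,h)‖ ≤ 1806(e+1)³` at EVERY prime power (`AppendixAEulerProductU004.
  norm_xiZero_prime_pow_le`; for `q ∣ dh`, `λ̃₀ⱼ(q^e,dh) = 1` so `ξ_j = ξ₀ⱼ`);
* `differentiableOn_xiPowSum` — the series `Σ_{r≥1} χ(q^r)ξ_j(q^r;d,h)q^{−rs}` is normally convergent on
  `σ > 9/10` (`|·| ≤ 1806(r+2)³q^{−9(r+1)/10}`), hence holomorphic (Mathlib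
  `differentiableOn_tsum_of_summable_norm`); `differentiableOn_pref` (denominator `1 − χ(q)q^{−s} ≠ 0`);
  **`differentiableOn_frakt`**;
* the tree's reduction `Lemma83.differentiableOn_tprod_frakt` (zl-w09-p2, `AppendixAStepAu007Closers`:
  the Weierstrass engine `Literature.Analysis.Complex.differentiableOn_tprod_of_norm_sub_one_le` of LIB-C D1,
  Conway VII.5.9, with the majorant `Lemma83.norm_frakt_sub_one_le_all`
  `‖𝔱_j − 1‖ ≤ 26·10⁶q^{−9/5} + [q∣dh]·4q^{−9/10}`, summable over the primes).

With the `σ > 1` Euler product `Lemma83.hasProd_frakt_calU` (`AppendixAEulerProductU004`) this gives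
`tprod_frakt_eq_calU : ∏'_q 𝔱_j(d,h,s;q) = 𝒰_j(d,h;s)` (`σ > 1`), and — through zl-w09-p2's reductions
`stepA_u007_analytic_of_factors` / `stepA_u007_read_of_factors` — **both App. A leaves of
`Skeleton.theorem1_of_leaves_v20` by name**: `Typed.AppendixA1.stepA_u007_analytic_holds : ∀ c′,
StepA_u007_analytic c′` (hAn) and `Typed.AppendixA1.stepA_u007_read_holds : ∀ c′, StepA_u007_read c′` (hRead).
Downstream (tree edges, for the skeleton pen — not restated here): `Lemma83.lemma83Rel_of_parts` then gives
`Skeleton.Lemma83Rel c′`, `Skeleton.lemma84Rel_of_lemma83Rel` gives `Lemma84Rel c′`, and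
`Section9Gathering.step9u004r_of_appendixA` / `Typed.Sec10C.gather1422_of_lemma84Rel` give the §9/§10 leaves
already plugged over `h84` in `theorem1_of_leaves_v20`.

## References

* Y. Zhang, arXiv:2211.02515v1 (2022), App. A p. 101 (tex L4988–L5002). [cite: Zhang2022LandauSiegel, App. A p.101]
* J. B. Conway, *Functions of One Complex Variable I* (1978), VII.5.9. [cite: Conway1978, VII.5.9]
-/

noncomputable section

open Complex Real Finset Filter Topology

namespace Literature.NumberTheory.LFunctions.Zhang2022.Lemma83

open Literature.NumberTheory.LFunctions.Zhang2022
open Literature.NumberTheory.LFunctions.Zhang2022.Skeleton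
open Literature.NumberTheory.LFunctions.Zhang2022.Typed.AppendixA1

/-! ## `ξ_j(q^e;d,h)` is polynomially bounded at every prime power -/

/-- **`‖ξ_j(q^e;d,h)‖ ≤ 1806(e+1)³` at every prime power** (`e ≥ 1`), App. A's `ξ_j = xiA`: for `q ∤ dh`
this is `AppendixALemma83Generic.norm_xiA_prime_pow_le` (`≤ 258(e+1)³`); for `q ∣ dh`, `λ̃₀ⱼ(q^e,dh) = 1`
so `ξ_j(q^e;d,h) = ξ₀ⱼ(q^e;d,h)` and `norm_xiZero_prime_pow_le` applies (Cases 2–3).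
[cite: Zhang2022LandauSiegel, App. A pp.102–103] -/
theorem norm_xiA_prime_pow_le_all (c' : ℝ) (D : ℕ) (j : ℕ) {q e : ℕ} (hq : q.Prime) (he : e ≠ 0)
    (d h : ℕ) : ‖xiA c' D j (q ^ e) d h‖ ≤ 1806 * ((e : ℝ) + 1) ^ 3 := by
  by_cases hqdh : Nat.Coprime q (d * h)
  · have hqd : ¬ q ∣ d := fun h' => (Nat.Prime.coprime_iff_not_dvd hq).mp hqdh (dvd_mul_of_dvd_left h' h)
    have hqh : ¬ q ∣ h := fun h' => (Nat.Prime.coprime_iff_not_dvd hq).mp hqdh (dvd_mul_of_dvd_right h' d)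
    have := norm_xiA_prime_pow_le c' D j hq hqd hqh (Nat.one_le_iff_ne_zero.mpr he)
    have h0 : (0 : ℝ) ≤ ((e : ℝ) + 1) ^ 3 := by positivity
    linarith
  · have h1 : lamTildeZero c' D j (q ^ e) (d * h) = 1 := by
      rw [lamTildeZero_prime_pow c' D hq he, if_neg hqdh]
    have h2 : xiA c' D j (q ^ e) d h = xiZero c' D j (q ^ e) d h := by
      rw [xiZero_eq c' D j (q ^ e) d h, h1, one_mul]
    rw [h2]
    exact norm_xiZero_prime_pow_le c' D j hq he d h

/-! ## Holomorphy of the local factors on `σ > 9/10` -/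

/-- The half-plane `σ > 9/10` is open. [folklore] -/
private theorem isOpen_U' : IsOpen {s : ℂ | 9 / 10 < s.re} :=
  isOpen_lt continuous_const Complex.continuous_re

/-- **The local series `Σ_{r≥1} χ(q^r)ξ_j(q^r;d,h)q^{−rs}` (`xiPowSum`) is holomorphic on `σ > 9/10`**
(normally convergent: `|χ(q^{r+1})ξ_j(q^{r+1};d,h)q^{−(r+1)s}| ≤ 1806(r+2)³q^{−9(r+1)/10}`), for every prime
`q` and all `d, h`. [cite: Zhang2022LandauSiegel, App. A p.101, tex L4988–L4999] -/
theorem differentiableOn_xiPowSum (c' : ℝ) {D : ℕ} (χ : DirichletCharacter ℂ D) (j : ℕ) (d h : ℕ)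
    {q : ℕ} (hq : q.Prime) :
    DifferentiableOn ℂ (fun s => xiPowSum c' χ j d h s q) {s : ℂ | 9 / 10 < s.re} := by
  classical
  have hq0 : (0 : ℝ) < q := by exact_mod_cast hq.pos
  have hq1 : (1 : ℝ) ≤ q := by exact_mod_cast hq.one_lt.le
  have hqC : (q : ℂ) ≠ 0 := by exact_mod_cast hq.ne_zero
  set ρ : ℝ := (q : ℝ) ^ (-(9 / 10 : ℝ)) with hρ
  have hρ0 : 0 < ρ := Real.rpow_pos_of_pos hq0 _
  have hρ1 : ρ < 1 := Real.rpow_lt_one_of_one_lt_of_neg (by exact_mod_cast hq.one_lt) (by norm_num)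
  -- the summands and their majorant
  set F : ℕ → ℂ → ℂ := fun r s =>
    χ ((q ^ (r + 1) : ℕ) : ZMod D) * xiA c' D j (q ^ (r + 1)) d h /
      (q : ℂ) ^ (((r + 1 : ℕ) : ℂ) * s) with hF
  set u : ℕ → ℝ := fun r => 1806 * ((r : ℝ) + 2) ^ 3 * ρ ^ (r + 1) with hu
  have hu_sum : Summable u := by
    have h : Summable (fun n : ℕ => ((n : ℝ) + 2) ^ 3 * ρ ^ n) := by
      have h3 : Summable (fun n : ℕ => (n : ℝ) ^ 3 * ρ ^ n) :=
        summable_pow_mul_geometric_of_norm_lt_one 3 (by rw [Real.norm_eq_abs, abs_of_pos hρ0]; exact hρ1)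
      have h2 : Summable (fun n : ℕ => (n : ℝ) ^ 2 * ρ ^ n) :=
        summable_pow_mul_geometric_of_norm_lt_one 2 (by rw [Real.norm_eq_abs, abs_of_pos hρ0]; exact hρ1)
      have h1 : Summable (fun n : ℕ => (n : ℝ) ^ 1 * ρ ^ n) :=
        summable_pow_mul_geometric_of_norm_lt_one 1 (by rw [Real.norm_eq_abs, abs_of_pos hρ0]; exact hρ1)
      have h0 : Summable (fun n : ℕ => ρ ^ n) := summable_geometric_of_lt_one hρ0.le hρ1
      have := ((h3.add (h2.mul_left 6)).add (h1.mul_left 12)).add (h0.mul_left 8)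
      refine this.congr fun n => ?_
      ring
    have := (h.mul_left 1806).mul_right ρ
    refine this.congr fun n => ?_
    simp only [hu, pow_succ]
    ring
  have hF_diff : ∀ r, DifferentiableOn ℂ (F r) {s : ℂ | 9 / 10 < s.re} := by
    intro r
    simp only [hF]
    refine DifferentiableOn.div (differentiableOn_const _) ?_ fun s _ => ?_
    · intro s _
      exact ((differentiableAt_id.const_mul (((r + 1 : ℕ) : ℂ))).const_cpow
        (Or.inl hqC)).differentiableWithinAt
    · exact fun h0 => hqC (Complex.cpow_eq_zero_iff _ _ |>.mp h0).1
  have hF_le : ∀ (r : ℕ) (s : ℂ), s ∈ {s : ℂ | 9 / 10 < s.re} → ‖F r s‖ ≤ u r := by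
    intro r s hs
    have hs' : 9 / 10 < s.re := hs
    simp only [hF, hu]
    have hden : ‖(q : ℂ) ^ (((r + 1 : ℕ) : ℂ) * s)‖ = (q : ℝ) ^ (((r + 1 : ℕ) : ℝ) * s.re) := by
      rw [Complex.norm_natCast_cpow_of_pos hq.pos]
      congr 1
      simp
    have hr0 : (0 : ℝ) < ((r + 1 : ℕ) : ℝ) := by positivity
    have hlow : (q : ℝ) ^ (((r + 1 : ℕ) : ℝ) * (9 / 10)) ≤ (q : ℝ) ^ (((r + 1 : ℕ) : ℝ) * s.re) :=
      Real.rpow_le_rpow_of_exponent_le hq1 (by nlinarith)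
    have hpos : 0 < (q : ℝ) ^ (((r + 1 : ℕ) : ℝ) * (9 / 10)) := Real.rpow_pos_of_pos hq0 _
    have hρr : ρ ^ (r + 1) = ((q : ℝ) ^ (((r + 1 : ℕ) : ℝ) * (9 / 10)))⁻¹ := by
      rw [hρ, ← Real.rpow_natCast, ← Real.rpow_mul hq0.le, ← Real.rpow_neg hq0.le]
      congr 1; push_cast; ring
    have hχ : ‖χ ((q ^ (r + 1) : ℕ) : ZMod D)‖ ≤ 1 := χ.norm_le_one _
    have hxi := norm_xiA_prime_pow_le_all c' D j hq (Nat.succ_ne_zero r) d h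
    rw [norm_div, hden, norm_mul]
    calc ‖χ ((q ^ (r + 1) : ℕ) : ZMod D)‖ * ‖xiA c' D j (q ^ (r + 1)) d h‖ /
          (q : ℝ) ^ (((r + 1 : ℕ) : ℝ) * s.re)
        ≤ 1 * (1806 * ((((r + 1 : ℕ) : ℝ)) + 1) ^ 3) / (q : ℝ) ^ (((r + 1 : ℕ) : ℝ) * (9 / 10)) := by
          gcongr
      _ = 1806 * ((r : ℝ) + 2) ^ 3 * ρ ^ (r + 1) := by
          rw [hρr, div_eq_mul_inv]; push_cast; ring
  have key := differentiableOn_tsum_of_summable_norm hu_sum hF_diff isOpen_U' hF_le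
  have hfun : (fun s => xiPowSum c' χ j d h s q) = fun s => ∑' r, F r s := by
    funext s; rfl
  rw [hfun]
  exact key

/-- For `‖w‖ ≤ 1`, `‖z‖ < 1`: `1 − wz ≠ 0`. [folklore] -/
private theorem one_sub_ne_zero_of_norm_lt' {z w : ℂ} (hw : ‖w‖ ≤ 1) (hz : ‖z‖ < 1) :
    1 - w * z ≠ 0 := by
  intro h
  have h1 : w * z = 1 := by linear_combination -h
  have : ‖w * z‖ < 1 := by
    rw [norm_mul]
    calc ‖w‖ * ‖z‖ ≤ 1 * ‖z‖ := by gcongr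
      _ = ‖z‖ := one_mul _
      _ < 1 := hz
  rw [h1, norm_one] at this
  exact lt_irrefl _ this

/-- **The first factor `pref = (1−χ(q)q^{−s−β_{j+1}})(1−χ(q)q^{−s−β_{j+2}})/(1−χ(q)q^{−s})` of `𝔱_j` is
holomorphic on `σ > 9/10`** (the denominator does not vanish: `|χ(q)q^{−s}| ≤ q^{−σ} < 1`).
[cite: Zhang2022LandauSiegel, App. A p.101, tex L4988] -/
theorem differentiableOn_pref (c' : ℝ) {D : ℕ} (χ : DirichletCharacter ℂ D) (j : ℕ) {q : ℕ}
    (hq : q.Prime) :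
    DifferentiableOn ℂ (fun s => pref c' χ j s q) {s : ℂ | 9 / 10 < s.re} := by
  have hqC : (q : ℂ) ≠ 0 := by exact_mod_cast hq.ne_zero
  have hcpow : ∀ β : ℂ, DifferentiableOn ℂ (fun s : ℂ => (q : ℂ) ^ (-(s + β))) {s : ℂ | 9 / 10 < s.re} :=
    fun β s _ =>
      (((differentiableAt_id.add_const β).neg).const_cpow (Or.inl hqC)).differentiableWithinAt
  have hcpow0 : DifferentiableOn ℂ (fun s : ℂ => (q : ℂ) ^ (-s)) {s : ℂ | 9 / 10 < s.re} :=
    fun s _ => ((differentiableAt_id.neg).const_cpow (Or.inl hqC)).differentiableWithinAt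
  have hden : ∀ s ∈ {s : ℂ | 9 / 10 < s.re}, (1 - χ (q : ZMod D) * (q : ℂ) ^ (-s)) ≠ 0 := by
    intro s hs
    have hs' : 9 / 10 < s.re := hs
    have hz : ‖(q : ℂ) ^ (-s)‖ < 1 := by
      rw [Complex.norm_natCast_cpow_of_pos hq.pos, Complex.neg_re]
      exact Real.rpow_lt_one_of_one_lt_of_neg (by exact_mod_cast hq.one_lt) (by linarith)
    exact one_sub_ne_zero_of_norm_lt' (DirichletCharacter.norm_le_one χ _) hz
  unfold pref
  refine DifferentiableOn.div ?_ ?_ hden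
  · exact ((differentiableOn_const _).sub ((differentiableOn_const _).mul (hcpow _))).mul
      ((differentiableOn_const _).sub ((differentiableOn_const _).mul (hcpow _)))
  · exact (differentiableOn_const _).sub ((differentiableOn_const _).mul hcpow0)

/-- **Each local factor `𝔱_j(d,h,·;q) = pref·(1 + λ̃(q,dh;1−β_j)·xiPowSum)` is holomorphic on
`σ > 9/10`**, for every prime `q`, every `D`, every Dirichlet character and all `j, d, h`.
[cite: Zhang2022LandauSiegel, App. A p.101, tex L4988–L4999] -/
theorem differentiableOn_frakt (c' : ℝ) {D : ℕ} (χ : DirichletCharacter ℂ D) (j : ℕ) (d h : ℕ) {q : ℕ}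
    (hq : q.Prime) :
    DifferentiableOn ℂ (fun s => frakt c' χ j d h s q) {s : ℂ | 9 / 10 < s.re} := by
  unfold frakt
  exact (differentiableOn_pref c' χ j hq).mul ((differentiableOn_const _).add
    ((differentiableOn_const _).mul (differentiableOn_xiPowSum c' χ j d h hq)))

/-! ## Holomorphy of the Euler product `∏'_q 𝔱_j(d,h,s;q)` on `σ > 9/10`, and the two leaves -/

/-- **`s ↦ ∏'_q 𝔱_j(d,h,s;q)` is holomorphic on `σ > 9/10`** ("so `𝒰_j(d,h;s)` is analytic in this
region", App. A tex L4999), for every `D`, every Dirichlet character, `1 ≤ j ≤ 3`, `d, h ≥ 1` — the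
tree's reduction `Lemma83.differentiableOn_tprod_frakt` (zl-w09-p2, Weierstrass engine
`Literature.Analysis.Complex.differentiableOn_tprod_of_norm_sub_one_le` + majorant
`norm_frakt_sub_one_le_all`) fed with `differentiableOn_frakt`. [cite: Zhang2022LandauSiegel, App. A p.101, tex L4999] -/
theorem differentiableOn_eulerProduct_frakt (c' : ℝ) {D : ℕ} (χ : DirichletCharacter ℂ D) {j : ℕ}
    (hj : j ∈ ({1, 2, 3} : Finset ℕ)) {d h : ℕ} (hd : 1 ≤ d) (hh : 1 ≤ h) :
    DifferentiableOn ℂ (fun s => ∏' q : Nat.Primes, frakt c' χ j d h s q) {s : ℂ | 9 / 10 < s.re} :=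
  differentiableOn_tprod_frakt c' χ hj hd hh fun _ hq => differentiableOn_frakt c' χ j d h hq

/-- **`∏'_q 𝔱_j(d,h,s;q) = 𝒰_j(d,h;s)` for `σ > 1`** (the value of the Euler product of §A.u004,
`Lemma83.hasProd_frakt_calU`), for every `D ≥ 1`, every Dirichlet character, all `j`, `d, h ≥ 1`.
[cite: Zhang2022LandauSiegel, App. A p.101, tex L4982–L4986] -/
theorem tprod_frakt_eq_calU (c' : ℝ) {D : ℕ} [NeZero D] (χ : DirichletCharacter ℂ D) (j : ℕ)
    {d h : ℕ} (hd : 1 ≤ d) (hh : 1 ≤ h) {s : ℂ} (hs : 1 < s.re) :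
    ∏' q : Nat.Primes, frakt c' χ j d h s q = calU c' χ j d h s :=
  (hasProd_frakt_calU c' χ j (Nat.one_le_iff_ne_zero.mp hd) (Nat.one_le_iff_ne_zero.mp hh) hs).tprod_eq

/-- **The App. A core** (both sentences of §A.u007 rest on it): for all `D ≥ 1`, every real primitive `χ`,
`1 ≤ j ≤ 3`, `d, h ≥ 1` (the guards `(A)` and `dh < PT⁻²` are not used), `s ↦ ∏'_q 𝔱_j(d,h,s;q)` is
holomorphic on `σ > 9/10` and equals `𝒰_j(d,h;s)` for `σ > 1` — the hypothesis `hcore` of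
`Lemma83.stepA_u007_read_of_core`. [cite: Zhang2022LandauSiegel, App. A p.101] -/
theorem appendixA_core (c' : ℝ) :
    ForAllLarge fun D _ χ => AssumptionA D χ → ∀ j ∈ ({1, 2, 3} : Finset ℕ), ∀ d h : ℕ,
      1 ≤ d → 1 ≤ h → ((d * h : ℕ) : ℝ) < bigP D / bigT D ^ 2 →
        DifferentiableOn ℂ (fun s => ∏' q : Nat.Primes, frakt c' χ j d h s q) {s : ℂ | 9 / 10 < s.re} ∧
          ∀ s : ℂ, 1 < s.re → ∏' q : Nat.Primes, frakt c' χ j d h s q = calU c' χ j d h s :=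
  ⟨0, fun _ _ χ _ _ _ _ j hj _ _ hd hh _ =>
    ⟨differentiableOn_eulerProduct_frakt c' χ hj hd hh, fun _ hs => tprod_frakt_eq_calU c' χ j hd hh hs⟩⟩

end Literature.NumberTheory.LFunctions.Zhang2022.Lemma83

/-! ## The two App. A leaves of `Skeleton.theorem1_of_leaves_v20`: `hAn` and `hRead` HOLD -/

namespace Literature.NumberTheory.LFunctions.Zhang2022.Typed.AppendixA1

open Literature.NumberTheory.LFunctions.Zhang2022

/-- **Z22:§A.u007, first sentence, HOLDS — leaf `hAn` of `Skeleton.theorem1_of_leaves_v20`**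
(`Typed.AppendixA1.StepA_u007_analytic c′`, App. A p. 101 tex L4999: "so `𝒰_j(d,h;s)` is analytic in
this region [`σ > 9/10`]"): for all large `D` (indeed all `D ≥ 1`), every real primitive `χ (mod D)`,
`1 ≤ j ≤ 3`, `d, h ≥ 1` with `dh < PT⁻²`, the function `𝒰_j(d,h;s) = L(s,χ)/(L(s+β_{j+1},χ)L(s+β_{j+2},χ))·
Σ_m χ(m)ξ₀ⱼ(m;d,h)m^{−s}` (`σ > 1`) continues analytically to `σ > 9/10` — witness `U := ∏'_q 𝔱_j(d,h,·;q)`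
(holomorphic there by `Lemma83.differentiableOn_frakt` + the Weierstrass engine, and `= 𝒰_j` on `σ > 1` by
the Euler product `Lemma83.hasProd_frakt_calU`), via zl-w09-p2's reduction `stepA_u007_analytic_of_factors`.
Leaf claimant of record zl-w09-p1 (ZHANG-L WP09). [cite: Zhang2022LandauSiegel, App. A p.101, tex L4999] -/
theorem stepA_u007_analytic_holds (c' : ℝ) : StepA_u007_analytic c' :=
  stepA_u007_analytic_of_factors c' fun _ χ j _ d h _ _ _ hq => Lemma83.differentiableOn_frakt c' χ j d h hq

variable (c' : ℝ) in
/-- `StepA_u007_analytic` — `_holds` alias of `stepA_u007_analytic_holds` above under the fact's exact name, stated under the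
prover's own binders as section variables (appended 2026-08-28, D-0026 bookkeeping: the proof term is the
existing theorem of this file; no statement, definition or attribute is edited; no new named fact; the
ledger's debt table listed the fact unproved). [cite: Zhang2022LandauSiegel, App. A p.101, tex L4999] -/
theorem _root_.Literature.NumberTheory.LFunctions.Zhang2022.Typed.AppendixA1.StepA_u007_analytic_holds :
    _root_.Literature.NumberTheory.LFunctions.Zhang2022.Typed.AppendixA1.StepA_u007_analytic c' :=
  _root_.Literature.NumberTheory.LFunctions.Zhang2022.Typed.AppendixA1.stepA_u007_analytic_holds (c' := c')

/-- **Z22:§A.u007, second sentence (prefactor-free reading), HOLDS — leaf `hRead` of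
`Skeleton.theorem1_of_leaves_v20`** (`Typed.AppendixA1.StepA_u007_read c′`, App. A p. 101 tex L5000:
"`𝒰_j(d,h;s) = ∏_{q<D} 𝔱_j(d,h,s;q) + O(D^{−c})`" in `σ > 9/10`; typed uniformly on the half-plane and for
every continuation `U`, with `c = 3/10`): zl-w09-p2's tail engine and identity-theorem closer
`stepA_u007_read_of_factors` (`AppendixAStepAu007ReadTail/Read/Closers`) fed with the per-prime holomorphy
`Lemma83.differentiableOn_frakt`. Leaf claimant of record zl-w09-p2 (ZHANG-L WP09).
[cite: Zhang2022LandauSiegel, App. A p.101, tex L5000] -/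
theorem stepA_u007_read_holds (c' : ℝ) : StepA_u007_read c' :=
  stepA_u007_read_of_factors c' fun _ χ j _ d h _ _ _ hq => Lemma83.differentiableOn_frakt c' χ j d h hq

variable (c' : ℝ) in
/-- `StepA_u007_read` — `_holds` alias of `stepA_u007_read_holds` above under the fact's exact name, stated under the
prover's own binders as section variables (appended 2026-08-28, D-0026 bookkeeping: the proof term is the
existing theorem of this file; no statement, definition or attribute is edited; no new named fact; the
ledger's debt table listed the fact unproved). [cite: Zhang2022LandauSiegel, App. A p.101, tex L5000] -/
theorem _root_.Literature.NumberTheory.LFunctions.Zhang2022.Typed.AppendixA1.StepA_u007_read_holds :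
    _root_.Literature.NumberTheory.LFunctions.Zhang2022.Typed.AppendixA1.StepA_u007_read c' :=
  _root_.Literature.NumberTheory.LFunctions.Zhang2022.Typed.AppendixA1.stepA_u007_read_holds (c' := c')

end Literature.NumberTheory.LFunctions.Zhang2022.Typed.AppendixA1

end
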